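import Literature.NumberTheory.EllipticCurves.ModThreeCongruenceHarmonicPolars
import HarnessLib

/-!
# Mod-`3` congruences III-b: REVERSE congruences by the dual (harmonic-polar) transport of flexes
# (the dual Hesse pencil: Artebani–Dolgachev §3; reverse `n`-congruences: Fisher, §13)

Topic `Literature/NumberTheory/EllipticCurves`, namespace `Literature.NumberTheory.EllipticCurves.FlexTransport`.
Parts I/II (`ModThreeCongruenceFlexTransport`, `…Galois`) certify DIRECT (symplectic) `3`-congruences by a
projectivity of the point planes carrying the flexes of `E'` to the flexes of `E`. A REVERSE (anti-symplectic)
congruence [cite: Fisher2012Hessian, §13, Def. 13.1 (X_E^-(n))] admits no such projectivity; instead there is a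
projectivity `M′` from the DUAL plane of `E'` to the plane of `E` carrying the nine HARMONIC POLARS of `E'` — the
base points of the dual Hesse pencil [cite: ArtebaniDolgachev2009, §3 ("The harmonic polars, considered as points
in the dual plane, give the set of base points of a Hesse pencil")] — onto `E[3]`. This file proves that such an
`M′` (hypothesis `IsDualFlexTransport`, a finite certificate) yields a `Gal(F̄/F)`-equivariant isomorphism
`E'[3] ≃+ E[3]` (`exists_addEquiv_geomTorsion_three_dual`), whose conclusion is VERBATIM the body of the
Summits-side `O6.ModPCongruent W' W 3`. Everything is PROVED; no named fact.

## The map and the proof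

`dualTransport`: `O ↦ O`, `(x, y) ↦ (U/Z, V/Z)` with `(U, V, Z) = M′ · ĥ_{E'}(x, y)` (`hhat`, Part III-a). (i) It
lands in `E[3]` by the certificate; (ii) it is ODD because `ĥ(−P) = N′ᵀĥ(P)` (`hhat_negY`) and `M′N′ᵀ = N M′`
(certificate field `neg`); (iii) it is INJECTIVE on `E'[3]` because `M′ᵀ ĥ^hom_E` is a left inverse on flexes
(projective duality; certificate field `inv`); (iv) it is ADDITIVE: for collinear flexes `P, Q, R` of `E'` the
harmonic polars are concurrent (Part III-a `det_hhat_eq_zero_of_collinear`), so `M′ĥ(P), M′ĥ(Q), M′ĥ(R)` are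
collinear affine flexes of `E` and the secant theorem (tree `eval_weierstrass_secant_eq_zero_iff`,
[cite: SilvermanAEC2009, III.2, Group Law Algorithm 2.3]) gives `Φ(R) = −(Φ(P) + Φ(Q))`; (v) bijective since
`#E[3] = 9` [cite: SilvermanTate2015, §2.1, Thm. 2.1 (d)]; (vi) Galois-equivariant since defined over `F`
[cite: SilvermanAEC2009, III.§7].

`IsDualFlexTransport.of_baseChange` spells the certificate out in coordinates (polynomial identities in `x, y`
modulo `(W'(x, y), Ψ₃^{W'}(x))`, closed by `linear_combination` for explicit curves over `ℚ`).

## References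

* [ArtebaniDolgachev2009] M. Artebani, I. Dolgachev, *The Hesse pencil of plane cubic curves*, Enseign. Math.
  55 (2009), §3 (harmonic polars; the dual Hesse pencil).
* [Fisher2012Hessian] T. Fisher, *The Hessian of a genus one curve*, PLMS 104 (2012), §13, Def. 13.1.
* [SilvermanAEC2009] J. H. Silverman, *The Arithmetic of Elliptic Curves*, 2nd ed., III.2 (Group Law
  Algorithm 2.3), III.§7.
* [SilvermanTate2015] J. H. Silverman, J. Tate, *Rational Points on Elliptic Curves*, 2nd ed., §2.1, Thm. 2.1.
* [Kunz2005PlaneAlgebraicCurves] E. Kunz, *Introduction to Plane Algebraic Curves*, Ch. 10, Lemma 10.11.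
-/

set_option autoImplicit false

open MvPolynomial Matrix
open Literature.AlgebraicGeometry.PlaneCurves
open scoped Classical

namespace Literature.NumberTheory.EllipticCurves.FlexTransport

universe u


section DualTransport

variable {K : Type u} [Field K]

/-- The homogenised harmonic-polar vector (degree-`2` forms): `ĥ^hom(X, Y, Z)`, with
`ĥ^hom(x, y, 1) = ĥ(x, y)`. [cite: ArtebaniDolgachev2009, §3 (harmonic polars)] -/
def hhatH (W : WeierstrassCurve K) (X : Fin 3 → K) : Fin 3 → K :=
  ![3 * X 0 ^ 2 + (W.a₁ ^ 2 + 2 * W.a₂) * X 0 * X 2 + W.a₁ * X 1 * X 2 + (W.a₁ * W.a₃ + W.a₄) * X 2 ^ 2,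
    (2 * X 1 + W.a₁ * X 0 + W.a₃ * X 2) * X 2,
    3 * X 1 ^ 2 + 3 * W.a₁ * X 0 * X 1 + (W.a₁ ^ 2 + W.a₂) * X 0 ^ 2 + 4 * W.a₃ * X 1 * X 2
      + (3 * W.a₁ * W.a₃ + 2 * W.a₄) * X 0 * X 2 + (2 * W.a₃ ^ 2 + 3 * W.a₆) * X 2 ^ 2]

/-- `ĥ^hom` is homogeneous of degree `2`. [cite: ArtebaniDolgachev2009, §3 (harmonic polars)] -/
theorem hhatH_smul (W : WeierstrassCurve K) (c : K) (X : Fin 3 → K) :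
    hhatH W (c • X) = c ^ 2 • hhatH W X := by
  funext i; fin_cases i <;> simp [hhatH] <;> ring

/-- `ĥ^hom(x, y, 1) = ĥ(x, y)`. [cite: ArtebaniDolgachev2009, §3 (harmonic polars)] -/
theorem hhatH_affine (W : WeierstrassCurve K) (x y : K) : hhatH W ![x, y, 1] = hhat W x y := by
  funext i; fin_cases i <;> simp [hhatH, hhat] <;> ring

/-- **The dual datum**: a `3 × 3` matrix `M′` (dual plane of `E'` → plane of `E`).
[cite: ArtebaniDolgachev2009, §3 (the dual Hesse pencil)] [cite: Fisher2012Hessian, §13, Def. 13.1 (reverse congruences)] -/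
@[ext] structure DualDatum (K : Type u) where
  (m₁₁ m₁₂ m₁₃ m₂₁ m₂₂ m₂₃ m₃₁ m₃₂ m₃₃ : K)

namespace DualDatum

variable (d : DualDatum K)

/-- The matrix of the dual datum. [cite: ArtebaniDolgachev2009, §3 (the dual Hesse pencil)] -/
def mat : Matrix (Fin 3) (Fin 3) K :=
  Matrix.of ![![d.m₁₁, d.m₁₂, d.m₁₃], ![d.m₂₁, d.m₂₂, d.m₂₃], ![d.m₃₁, d.m₃₂, d.m₃₃]]

/-- The homogeneous image `(U, V, Z) = M′ ĥ_{E'}(x, y)` of the affine point `(x, y)`.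
[cite: ArtebaniDolgachev2009, §3 (harmonic polars)] -/
def vec (E' : WeierstrassCurve K) (x y : K) : Fin 3 → K := d.mat *ᵥ hhat E' x y

/-- Abscissa of the dual transport: `U/Z`. [cite: ArtebaniDolgachev2009, §3 (harmonic polars)] -/
def u (E' : WeierstrassCurve K) (x y : K) : K := d.vec E' x y 0 / d.vec E' x y 2

/-- Ordinate of the dual transport: `V/Z`. [cite: ArtebaniDolgachev2009, §3 (harmonic polars)] -/
def v (E' : WeierstrassCurve K) (x y : K) : K := d.vec E' x y 1 / d.vec E' x y 2

/-- Base change of a dual datum along a ring map. [cite: ArtebaniDolgachev2009, §3 (the dual Hesse pencil)] -/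
def map {L : Type u} [Field L] (f : K →+* L) : DualDatum L :=
  ⟨f d.m₁₁, f d.m₁₂, f d.m₁₃, f d.m₂₁, f d.m₂₂, f d.m₂₃, f d.m₃₁, f d.m₃₂, f d.m₃₃⟩

/-- The matrix of the base-changed datum. [cite: ArtebaniDolgachev2009, §3 (the dual Hesse pencil)] -/
theorem map_mat {L : Type u} [Field L] (f : K →+* L) : (d.map f).mat = d.mat.map f := by
  ext i j; fin_cases i <;> fin_cases j <;> rfl


/-- The determinant of the dual datum, written out. [cite: ArtebaniDolgachev2009, §3 (the dual Hesse pencil)] -/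
theorem det_mat_eq : d.mat.det =
    d.m₁₁ * (d.m₂₂ * d.m₃₃ - d.m₂₃ * d.m₃₂) - d.m₁₂ * (d.m₂₁ * d.m₃₃ - d.m₂₃ * d.m₃₁)
      + d.m₁₃ * (d.m₂₁ * d.m₃₂ - d.m₂₂ * d.m₃₁) := by
  rw [mat, Matrix.det_fin_three]; simp; ring

/-- The intertwining of the negations `M′N′ᵀ = N M′` from five scalar equations (the other four entries agree
identically; `N′ᵀ` has rows `(1, −a₁′, 0), (0, −1, 0), (0, −a₃′, 1)`, `N` has rows `(1, 0, 0), (−a₁, −1, −a₃),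
(0, 0, 1)`). [cite: Kunz2005PlaneAlgebraicCurves, Ch. 10, proof of Lemma 10.11] -/
theorem neg_of_eqs (a₁ a₃ a₁' a₃' : K)
    (h₁ : d.m₁₁ * a₁' + 2 * d.m₁₂ + d.m₁₃ * a₃' = 0)
    (h₂ : 2 * d.m₂₁ = -a₁ * d.m₁₁ - a₃ * d.m₃₁)
    (h₃ : d.m₂₁ * a₁' + d.m₂₃ * a₃' = a₁ * d.m₁₂ + a₃ * d.m₃₂)
    (h₄ : 2 * d.m₂₃ = -a₁ * d.m₁₃ - a₃ * d.m₃₃)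
    (h₅ : d.m₃₁ * a₁' + 2 * d.m₃₂ + d.m₃₃ * a₃' = 0) :
    d.mat * Matrix.of ![![(1 : K), -a₁', 0], ![0, -1, 0], ![0, -a₃', 1]] =
      Matrix.of ![![(1 : K), 0, 0], ![-a₁, -1, -a₃], ![0, 0, 1]] * d.mat := by
  ext i j
  fin_cases i <;> fin_cases j <;> simp [mat, Matrix.mul_apply, Fin.sum_univ_three]
  · linear_combination -h₁
  · linear_combination h₂
  · linear_combination -h₃
  · linear_combination h₄
  · linear_combination -h₅

end DualDatum

/-- `ĥ` commutes with base change. [cite: ArtebaniDolgachev2009, §3 (harmonic polars)] -/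
theorem hhat_map {L : Type u} [Field L] (f : K →+* L) (E' : WeierstrassCurve K) (x y : K) :
    hhat (E'.map f) (f x) (f y) = f ∘ hhat E' x y := by
  funext i
  fin_cases i <;> simp [hhat, WeierstrassCurve.map_a₁, WeierstrassCurve.map_a₂, WeierstrassCurve.map_a₃,
    WeierstrassCurve.map_a₄, WeierstrassCurve.map_a₆, map_ofNat]

/-- The homogeneous image commutes with base change. [cite: ArtebaniDolgachev2009, §3 (harmonic polars)] -/
theorem DualDatum.vec_map {L : Type u} [Field L] (d : DualDatum K) (f : K →+* L) (E' : WeierstrassCurve K)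
    (x y : K) : (d.map f).vec (E'.map f) (f x) (f y) = f ∘ d.vec E' x y := by
  rw [DualDatum.vec, DualDatum.map_mat, hhat_map, DualDatum.vec]
  funext i
  simp [Matrix.mulVec, dotProduct, Fin.sum_univ_three]

variable (E E' : WeierstrassCurve K) (d : DualDatum K)

/-- **The dual transport of affine points**: `O ↦ O`, `(x, y) ↦ (U/Z, V/Z)` with `(U, V, Z) = M′ĥ_{E'}(x, y)`
when that is a nonsingular point of `E` (junk value `O` otherwise, never used on `E'[3]`).
[cite: ArtebaniDolgachev2009, §3 (harmonic polars, the dual Hesse pencil)] [cite: Fisher2012Hessian, §13, Def. 13.1] -/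
noncomputable def dualTransport : E'.toAffine.Point → E.toAffine.Point
  | .zero => 0
  | .some x y _ => if h : E.toAffine.Nonsingular (d.u E' x y) (d.v E' x y) then .some _ _ h else 0

/-- The dual transport sends `O` to `O`. [cite: ArtebaniDolgachev2009, §3 (harmonic polars)] -/
@[simp] theorem dualTransport_zero : dualTransport E E' d 0 = 0 := rfl

/-- The dual transport of an affine point whose image is a point of `E`. [cite: ArtebaniDolgachev2009, §3 (harmonic polars)] -/
theorem dualTransport_some {x y : K} (h : E'.toAffine.Nonsingular x y)
    (h' : E.toAffine.Nonsingular (d.u E' x y) (d.v E' x y)) :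
    dualTransport E E' d (.some x y h) = .some _ _ h' := by
  show (if h : E.toAffine.Nonsingular (d.u E' x y) (d.v E' x y) then
    WeierstrassCurve.Affine.Point.some _ _ h else 0) = _
  rw [dif_pos h']

variable {E E' d}

/-- **The certificate for a reverse `3`-congruence** (`IsDualFlexTransport`): `2 ≠ 0`, `det M′ ≠ 0`; every
affine flex `(x, y)` of `E'` goes to an affine flex of `E` (`Z ≠ 0`, the point `(U/Z, V/Z)` is on `E` with
`Ψ₃^{E} = 0`); the negation matrices are intertwined, `M′ N_{E'}ᵀ = N_E M′`; and the transposed datum is a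
left inverse on flexes: `M′ᵀ ĥ^hom_E(M′ĥ_{E'}(x, y)) ∝ (x, y, 1)` with non-zero last coordinate.
[cite: ArtebaniDolgachev2009, §3 (the dual Hesse pencil)] [cite: Fisher2012Hessian, §13, Def. 13.1 (X_E^-(n))] -/
structure IsDualFlexTransport (E E' : WeierstrassCurve K) (d : DualDatum K) : Prop where
  two_ne_zero : (2 : K) ≠ 0
  det_ne_zero : d.mat.det ≠ 0
  cert : ∀ x y : K, E'.toAffine.Equation x y → E'.Ψ₃.eval x = 0 →
    d.vec E' x y 2 ≠ 0 ∧ E.toAffine.Equation (d.u E' x y) (d.v E' x y) ∧ E.Ψ₃.eval (d.u E' x y) = 0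
  neg : d.mat * Matrix.of ![![(1 : K), -E'.a₁, 0], ![0, -1, 0], ![0, -E'.a₃, 1]] =
    Matrix.of ![![(1 : K), 0, 0], ![-E.a₁, -1, -E.a₃], ![0, 0, 1]] * d.mat
  inv : ∀ x y : K, E'.toAffine.Equation x y → E'.Ψ₃.eval x = 0 →
    (d.matᵀ *ᵥ hhatH E (d.vec E' x y)) 2 ≠ 0 ∧
      (d.matᵀ *ᵥ hhatH E (d.vec E' x y)) 0 = x * (d.matᵀ *ᵥ hhatH E (d.vec E' x y)) 2 ∧
      (d.matᵀ *ᵥ hhatH E (d.vec E' x y)) 1 = y * (d.matᵀ *ᵥ hhatH E (d.vec E' x y)) 2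

namespace IsDualFlexTransport

variable (hc : IsDualFlexTransport E E' d)
include hc

/-- On an affine point of order `3`, `Z ≠ 0`. [cite: ArtebaniDolgachev2009, §3 (harmonic polars)] -/
theorem Z_ne_zero {x y : K} (h : E'.toAffine.Nonsingular x y)
    (h3 : (3 : ℤ) • (WeierstrassCurve.Affine.Point.some x y h) = 0) : d.vec E' x y 2 ≠ 0 :=
  (hc.cert x y h.1 ((three_zsmul_some_eq_zero_iff E' h).1 h3)).1

/-- The homogeneous image is `Z • (u, v, 1)`. [cite: ArtebaniDolgachev2009, §3 (harmonic polars)] -/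
theorem vec_eq {x y : K} (h : E'.toAffine.Nonsingular x y)
    (h3 : (3 : ℤ) • (WeierstrassCurve.Affine.Point.some x y h) = 0) :
    d.vec E' x y = d.vec E' x y 2 • ![d.u E' x y, d.v E' x y, 1] := by
  have hZ := hc.Z_ne_zero h h3
  funext i; fin_cases i
  · simp [DualDatum.u, mul_div_cancel₀ _ hZ]
  · simp [DualDatum.v, mul_div_cancel₀ _ hZ]
  · simp

/-- Images of three collinear affine flexes under the dual transport are collinear: concurrence of the
harmonic polars (`det_hhat_eq_zero_of_collinear`) and linearity of `M′`.
[cite: ArtebaniDolgachev2009, §3 (the nine harmonic polars = base points of the dual Hesse pencil)] -/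
theorem collinear_transport {x₁ y₁ x₂ y₂ x₃ y₃ : K} (h₁ : E'.toAffine.Nonsingular x₁ y₁)
    (h₂ : E'.toAffine.Nonsingular x₂ y₂) (h₃ : E'.toAffine.Nonsingular x₃ y₃)
    (hP₁ : (3 : ℤ) • WeierstrassCurve.Affine.Point.some x₁ y₁ h₁ = 0)
    (hP₂ : (3 : ℤ) • WeierstrassCurve.Affine.Point.some x₂ y₂ h₂ = 0)
    (hP₃ : (3 : ℤ) • WeierstrassCurve.Affine.Point.some x₃ y₃ h₃ = 0)
    (h₁₂ : (x₁, y₁) ≠ (x₂, y₂)) (h₁₃ : (x₁, y₁) ≠ (x₃, y₃)) (h₂₃ : (x₂, y₂) ≠ (x₃, y₃))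
    (hcol : (y₂ - y₁) * (x₃ - x₁) = (y₃ - y₁) * (x₂ - x₁)) :
    (d.v E' x₂ y₂ - d.v E' x₁ y₁) * (d.u E' x₃ y₃ - d.u E' x₁ y₁) =
      (d.v E' x₃ y₃ - d.v E' x₁ y₁) * (d.u E' x₂ y₂ - d.u E' x₁ y₁) := by
  have hdet := det_hhat_eq_zero_of_collinear E' hc.two_ne_zero h₁ h₂ h₃ hP₁ hP₂ hP₃ h₁₂ h₁₃ h₂₃ hcol
  have hZ₁ := hc.Z_ne_zero h₁ hP₁
  have hZ₂ := hc.Z_ne_zero h₂ hP₂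
  have hZ₃ := hc.Z_ne_zero h₃ hP₃
  -- the matrix of homogeneous images is `[ĥ] · M′ᵀ`
  have hV : Matrix.of ![d.vec E' x₁ y₁, d.vec E' x₂ y₂, d.vec E' x₃ y₃] =
      Matrix.of ![hhat E' x₁ y₁, hhat E' x₂ y₂, hhat E' x₃ y₃] * d.matᵀ := by
    ext i j
    fin_cases i <;> simp [DualDatum.vec, Matrix.mul_apply, Matrix.mulVec, dotProduct, Fin.sum_univ_three] <;> ring
  have hdetV : (Matrix.of ![d.vec E' x₁ y₁, d.vec E' x₂ y₂, d.vec E' x₃ y₃]).det = 0 := by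
    rw [hV, Matrix.det_mul, hdet, zero_mul]
  rw [hc.vec_eq h₁ hP₁, hc.vec_eq h₂ hP₂, hc.vec_eq h₃ hP₃, Matrix.det_fin_three] at hdetV
  simp at hdetV
  have key : d.vec E' x₁ y₁ 2 * d.vec E' x₂ y₂ 2 * d.vec E' x₃ y₃ 2 *
      ((d.v E' x₂ y₂ - d.v E' x₁ y₁) * (d.u E' x₃ y₃ - d.u E' x₁ y₁) -
        (d.v E' x₃ y₃ - d.v E' x₁ y₁) * (d.u E' x₂ y₂ - d.u E' x₁ y₁)) = 0 := by
    linear_combination -hdetV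
  rcases mul_eq_zero.1 key with h0 | h0
  · exfalso
    rcases mul_eq_zero.1 h0 with h0' | h0'
    · rcases mul_eq_zero.1 h0' with h0'' | h0''
      · exact hZ₁ h0''
      · exact hZ₂ h0''
    · exact hZ₃ h0'
  · linear_combination h0

variable [E.IsElliptic]

/-- On an affine point of order `3`, the transported pair is a nonsingular point of `E`.
[cite: ArtebaniDolgachev2009, §3 (harmonic polars)] -/
theorem nonsingular {x y : K} (h : E'.toAffine.Nonsingular x y)
    (h3 : (3 : ℤ) • (WeierstrassCurve.Affine.Point.some x y h) = 0) :
    E.toAffine.Nonsingular (d.u E' x y) (d.v E' x y) :=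
  (WeierstrassCurve.Affine.equation_iff_nonsingular (W := E.toAffine)).1
    (hc.cert x y h.1 ((three_zsmul_some_eq_zero_iff E' h).1 h3)).2.1

/-- On an affine point of order `3`, the dual transport is the affine point `(u, v)`.
[cite: ArtebaniDolgachev2009, §3 (harmonic polars)] -/
theorem transport_eq {x y : K} (h : E'.toAffine.Nonsingular x y)
    (h3 : (3 : ℤ) • (WeierstrassCurve.Affine.Point.some x y h) = 0) :
    dualTransport E E' d (.some x y h) = .some _ _ (hc.nonsingular h h3) :=
  dualTransport_some E E' d h _

/-- Flexes go to flexes: the transport of a point of order `3` has order `3`.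
[cite: SilvermanTate2015, §2.1, Thm. 2.1 (c)] [cite: ArtebaniDolgachev2009, §3] -/
theorem three_zsmul_transport {x y : K} (h : E'.toAffine.Nonsingular x y)
    (h3 : (3 : ℤ) • (WeierstrassCurve.Affine.Point.some x y h) = 0) :
    (3 : ℤ) • dualTransport E E' d (.some x y h) = 0 := by
  rw [hc.transport_eq h h3, three_zsmul_some_eq_zero_iff]
  exact (hc.cert x y h.1 ((three_zsmul_some_eq_zero_iff E' h).1 h3)).2.2

/-- The dual transport maps `E'[3]` into `E[3]`. [cite: SilvermanTate2015, §2.1, Thm. 2.1 (c)] -/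
theorem three_zsmul_transport_eq_zero {P : E'.toAffine.Point} (h3 : (3 : ℤ) • P = 0) :
    (3 : ℤ) • dualTransport E E' d P = 0 := by
  rcases P with _ | ⟨x, y, h⟩
  · rw [← WeierstrassCurve.Affine.Point.zero_def, dualTransport_zero, smul_zero]
  · exact hc.three_zsmul_transport h h3

/-- **Oddness** of the dual transport on `E'[3]`: `M′ĥ(−P) = M′N′ᵀĥ(P) = N·M′ĥ(P)` by `hhat_negY` and the
intertwining `neg`, and `N` is the negation of `E`. [cite: Kunz2005PlaneAlgebraicCurves, Ch. 10, Lemma 10.11]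
[cite: ArtebaniDolgachev2009, §3] -/
theorem transport_neg {P : E'.toAffine.Point} (h3 : (3 : ℤ) • P = 0) :
    dualTransport E E' d (-P) = -dualTransport E E' d P := by
  rcases P with _ | ⟨x, y, h⟩
  · rw [← WeierstrassCurve.Affine.Point.zero_def, neg_zero, dualTransport_zero, neg_zero]
  · have h3' : (3 : ℤ) • (-WeierstrassCurve.Affine.Point.some x y h) = 0 := by
      rw [zsmul_neg, h3, neg_zero]
    rw [WeierstrassCurve.Affine.Point.neg_some] at h3' ⊢
    rw [hc.transport_eq h h3, hc.transport_eq _ h3', WeierstrassCurve.Affine.Point.neg_some]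
    have hZ := hc.Z_ne_zero h h3
    -- the homogeneous image of `-P`
    have hvec : d.vec E' x (E'.toAffine.negY x y) =
        Matrix.of ![![(1 : K), 0, 0], ![-E.a₁, -1, -E.a₃], ![0, 0, 1]] *ᵥ d.vec E' x y := by
      rw [DualDatum.vec, hhat_negY, Matrix.mulVec_mulVec, hc.neg, ← Matrix.mulVec_mulVec, DualDatum.vec]
    have h0 : d.vec E' x (E'.toAffine.negY x y) 0 = d.vec E' x y 0 := by
      rw [hvec]; simp [Matrix.mulVec, dotProduct, Fin.sum_univ_three]
    have h1 : d.vec E' x (E'.toAffine.negY x y) 1 =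
        -E.a₁ * d.vec E' x y 0 - d.vec E' x y 1 - E.a₃ * d.vec E' x y 2 := by
      rw [hvec]; simp [Matrix.mulVec, dotProduct, Fin.sum_univ_three]; ring
    have h2 : d.vec E' x (E'.toAffine.negY x y) 2 = d.vec E' x y 2 := by
      rw [hvec]; simp [Matrix.mulVec, dotProduct, Fin.sum_univ_three]
    simp only [WeierstrassCurve.Affine.Point.some.injEq]
    refine ⟨?_, ?_⟩
    · rw [DualDatum.u, DualDatum.u, h0, h2]
    · rw [DualDatum.v, DualDatum.v, DualDatum.u, h1, h2, WeierstrassCurve.Affine.negY]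
      field_simp
      ring

/-- **Injectivity** of the dual transport on `E'[3]`, from the left inverse `M′ᵀ ĥ^hom_E` (projective
duality: the transposed datum is the dual transport back). [cite: ArtebaniDolgachev2009, §3 (the dual Hesse
pencil)] -/
theorem transport_injective {P Q : E'.toAffine.Point} (hP : (3 : ℤ) • P = 0) (hQ : (3 : ℤ) • Q = 0)
    (h : dualTransport E E' d P = dualTransport E E' d Q) : P = Q := by
  rcases P with _ | ⟨x₁, y₁, h₁⟩ <;> rcases Q with _ | ⟨x₂, y₂, h₂⟩
  · rfl
  · rw [← WeierstrassCurve.Affine.Point.zero_def, dualTransport_zero, hc.transport_eq h₂ hQ] at h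
    exact absurd h.symm (WeierstrassCurve.Affine.Point.some_ne_zero _)
  · rw [← WeierstrassCurve.Affine.Point.zero_def, dualTransport_zero, hc.transport_eq h₁ hP] at h
    exact absurd h (WeierstrassCurve.Affine.Point.some_ne_zero _)
  · rw [hc.transport_eq h₁ hP, hc.transport_eq h₂ hQ, WeierstrassCurve.Affine.Point.some.injEq] at h
    have hZ₁ := hc.Z_ne_zero h₁ hP
    have hZ₂ := hc.Z_ne_zero h₂ hQ
    have hv₁ := hc.vec_eq h₁ hP
    have hv₂ := hc.vec_eq h₂ hQ
    -- the two homogeneous images are proportional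
    have hprop : d.vec E' x₁ y₁ = (d.vec E' x₁ y₁ 2 * (d.vec E' x₂ y₂ 2)⁻¹) • d.vec E' x₂ y₂ := by
      rw [hv₁, h.1, h.2]
      conv_rhs => rw [hv₂]
      rw [smul_smul]
      congr 1
      simp [inv_mul_cancel_right₀ hZ₂]
    obtain ⟨hT₁2, hT₁0, hT₁1⟩ := hc.inv x₁ y₁ h₁.1 ((three_zsmul_some_eq_zero_iff E' h₁).1 hP)
    obtain ⟨hT₂2, hT₂0, hT₂1⟩ := hc.inv x₂ y₂ h₂.1 ((three_zsmul_some_eq_zero_iff E' h₂).1 hQ)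
    set c := d.vec E' x₁ y₁ 2 * (d.vec E' x₂ y₂ 2)⁻¹ with hcdef
    have hT : d.matᵀ *ᵥ hhatH E (d.vec E' x₁ y₁) = c ^ 2 • (d.matᵀ *ᵥ hhatH E (d.vec E' x₂ y₂)) := by
      rw [hprop, hhatH_smul, Matrix.mulVec_smul]
    have e0 := congrFun hT 0
    have e1 := congrFun hT 1
    have e2 := congrFun hT 2
    simp only [Pi.smul_apply, smul_eq_mul] at e0 e1 e2
    have hc2 : c ^ 2 ≠ 0 := by
      intro h0; apply hT₁2; rw [e2, h0, zero_mul]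
    have hx : x₁ = x₂ := by
      have := hT₁0
      rw [e0, e2, hT₂0] at this
      -- c² T₂0... : c^2 * (x₂ * T) = x₁ * (c^2 * T)
      have hT' : c ^ 2 * (d.matᵀ *ᵥ hhatH E (d.vec E' x₂ y₂)) 2 ≠ 0 := mul_ne_zero hc2 hT₂2
      have : (x₂ - x₁) * (c ^ 2 * (d.matᵀ *ᵥ hhatH E (d.vec E' x₂ y₂)) 2) = 0 := by
        linear_combination this
      rcases mul_eq_zero.1 this with h' | h'
      · linear_combination -h'
      · exact absurd h' hT'
    have hy : y₁ = y₂ := by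
      have := hT₁1
      rw [e1, e2, hT₂1] at this
      have hT' : c ^ 2 * (d.matᵀ *ᵥ hhatH E (d.vec E' x₂ y₂)) 2 ≠ 0 := mul_ne_zero hc2 hT₂2
      have : (y₂ - y₁) * (c ^ 2 * (d.matᵀ *ᵥ hhatH E (d.vec E' x₂ y₂)) 2) = 0 := by
        linear_combination this
      rcases mul_eq_zero.1 this with h' | h'
      · linear_combination -h'
      · exact absurd h' hT'
    subst hx; subst hy; rfl

/-- Two affine flexes with the same transported abscissa are equal or opposite.
[cite: SilvermanAEC2009, III.2, Group Law Algorithm 2.3] [cite: ArtebaniDolgachev2009, §3] -/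
theorem eq_or_eq_neg_of_u_eq {x₁ y₁ x₂ y₂ : K} (h₁ : E'.toAffine.Nonsingular x₁ y₁)
    (h₂ : E'.toAffine.Nonsingular x₂ y₂)
    (hP : (3 : ℤ) • WeierstrassCurve.Affine.Point.some x₁ y₁ h₁ = 0)
    (hQ : (3 : ℤ) • WeierstrassCurve.Affine.Point.some x₂ y₂ h₂ = 0)
    (hu : d.u E' x₁ y₁ = d.u E' x₂ y₂) :
    WeierstrassCurve.Affine.Point.some x₁ y₁ h₁ = WeierstrassCurve.Affine.Point.some x₂ y₂ h₂ ∨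
      WeierstrassCurve.Affine.Point.some x₁ y₁ h₁ = -WeierstrassCurve.Affine.Point.some x₂ y₂ h₂ := by
  have hE₁ := (hc.nonsingular h₁ hP).1
  have hE₂ := (hc.nonsingular h₂ hQ).1
  have hQ' : (3 : ℤ) • (-WeierstrassCurve.Affine.Point.some x₂ y₂ h₂) = 0 := by rw [zsmul_neg, hQ, neg_zero]
  rcases WeierstrassCurve.Affine.Y_eq_of_X_eq hE₁ hE₂ hu with hv | hv
  · left
    apply hc.transport_injective hP hQ
    rw [hc.transport_eq h₁ hP, hc.transport_eq h₂ hQ, WeierstrassCurve.Affine.Point.some.injEq]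
    exact ⟨hu, hv⟩
  · right
    apply hc.transport_injective hP hQ'
    rw [hc.transport_neg hQ, hc.transport_eq h₁ hP, hc.transport_eq h₂ hQ, WeierstrassCurve.Affine.Point.neg_some,
      WeierstrassCurve.Affine.Point.some.injEq]
    exact ⟨hu, hv⟩

/-- **Additivity of the dual transport on `E'[3]`** — as in Part I (`IsFlexTransport.transport_add`): for
`P, Q ∈ E'[3]` with distinct abscissae, `P, Q, R = −(P + Q)` are collinear flexes; their harmonic polars are
concurrent (`det_hhat_eq_zero_of_collinear`), so the images `M′ĥ(P), M′ĥ(Q), M′ĥ(R)` are collinear affine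
flexes of `E`, and the secant theorem on `E` (tree `eval_weierstrass_secant_eq_zero_iff`) identifies the third as
`−(U₁ + U₂)`; the cases `Q = ±P` follow from oddness and `2P = −P`. [cite: ArtebaniDolgachev2009, §3 (the dual
Hesse configuration)] [cite: SilvermanAEC2009, III.2, Group Law Algorithm 2.3] -/
theorem transport_add {P Q : E'.toAffine.Point} (hP : (3 : ℤ) • P = 0) (hQ : (3 : ℤ) • Q = 0) :
    dualTransport E E' d (P + Q) = dualTransport E E' d P + dualTransport E E' d Q := by
  rcases P with _ | ⟨x₁, y₁, h₁⟩
  · rw [← WeierstrassCurve.Affine.Point.zero_def, dualTransport_zero, zero_add, zero_add]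
  rcases Q with _ | ⟨x₂, y₂, h₂⟩
  · rw [← WeierstrassCurve.Affine.Point.zero_def, dualTransport_zero, add_zero, add_zero]
  by_cases hx : x₁ = x₂
  · subst hx
    by_cases hy : y₁ = E'.toAffine.negY x₁ y₂
    · -- `Q = -P`
      have hQP : WeierstrassCurve.Affine.Point.some x₁ y₂ h₂ = -WeierstrassCurve.Affine.Point.some x₁ y₁ h₁ := by
        rw [WeierstrassCurve.Affine.Point.neg_some, WeierstrassCurve.Affine.Point.some.injEq]
        exact ⟨rfl, by rw [hy, WeierstrassCurve.Affine.negY_negY]⟩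
      rw [WeierstrassCurve.Affine.Point.add_of_Y_eq rfl hy, dualTransport_zero, hQP, hc.transport_neg hP,
        add_neg_cancel]
    · -- `Q = P`
      have hy' : y₁ = y₂ := WeierstrassCurve.Affine.Y_eq_of_Y_ne h₁.1 h₂.1 rfl hy
      subst hy'
      rw [add_self_eq_neg_of_three_zsmul hP, hc.transport_neg hP,
        add_self_eq_neg_of_three_zsmul (hc.three_zsmul_transport_eq_zero hP)]
  · -- the chord case
    set ℓ := E'.toAffine.slope x₁ x₂ y₁ y₂ with hℓ
    set x₃ := E'.toAffine.addX x₁ x₂ ℓ with hx₃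
    set y₃ := E'.toAffine.negAddY x₁ x₂ y₁ ℓ with hy₃
    have h₃ : E'.toAffine.Nonsingular x₃ y₃ :=
      WeierstrassCurve.Affine.nonsingular_negAdd h₁ h₂ fun hxy => hx hxy.1
    have hPQ : WeierstrassCurve.Affine.Point.some x₁ y₁ h₁ + WeierstrassCurve.Affine.Point.some x₂ y₂ h₂ =
        -WeierstrassCurve.Affine.Point.some x₃ y₃ h₃ :=
      WeierstrassCurve.Affine.Point.add_of_X_ne' hx
    have hR : (3 : ℤ) • WeierstrassCurve.Affine.Point.some x₃ y₃ h₃ = 0 := by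
      have : WeierstrassCurve.Affine.Point.some x₃ y₃ h₃ =
          -(WeierstrassCurve.Affine.Point.some x₁ y₁ h₁ + WeierstrassCurve.Affine.Point.some x₂ y₂ h₂) := by
        rw [hPQ, neg_neg]
      rw [this, zsmul_neg, zsmul_add, hP, hQ, add_zero, neg_zero]
    -- `R ≠ P, Q` and `P ≠ Q` as pairs
    have h₁₂ : (x₁, y₁) ≠ (x₂, y₂) := fun h => hx (congrArg Prod.fst h)
    have hRP : ¬ (WeierstrassCurve.Affine.Point.some x₃ y₃ h₃ = WeierstrassCurve.Affine.Point.some x₁ y₁ h₁ ∨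
        WeierstrassCurve.Affine.Point.some x₃ y₃ h₃ = -WeierstrassCurve.Affine.Point.some x₁ y₁ h₁) := by
      rintro (hRP | hRP)
      · -- `R = P`: `P + Q = -P = P + P`, so `Q = P`
        have h' : WeierstrassCurve.Affine.Point.some x₁ y₁ h₁ + WeierstrassCurve.Affine.Point.some x₂ y₂ h₂ =
            WeierstrassCurve.Affine.Point.some x₁ y₁ h₁ + WeierstrassCurve.Affine.Point.some x₁ y₁ h₁ := by
          rw [hPQ, hRP, add_self_eq_neg_of_three_zsmul hP]
        have hQP := add_left_cancel h'
        rw [WeierstrassCurve.Affine.Point.some.injEq] at hQP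
        exact hx hQP.1.symm
      · -- `R = -P`: `P + Q = P`, so `Q = O`
        have h' : WeierstrassCurve.Affine.Point.some x₁ y₁ h₁ + WeierstrassCurve.Affine.Point.some x₂ y₂ h₂ =
            WeierstrassCurve.Affine.Point.some x₁ y₁ h₁ := by rw [hPQ, hRP, neg_neg]
        exact WeierstrassCurve.Affine.Point.some_ne_zero h₂ (add_eq_left.mp h')
    have hRQ : ¬ (WeierstrassCurve.Affine.Point.some x₃ y₃ h₃ = WeierstrassCurve.Affine.Point.some x₂ y₂ h₂ ∨
        WeierstrassCurve.Affine.Point.some x₃ y₃ h₃ = -WeierstrassCurve.Affine.Point.some x₂ y₂ h₂) := by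
      rintro (hRQ | hRQ)
      · have h' : WeierstrassCurve.Affine.Point.some x₁ y₁ h₁ + WeierstrassCurve.Affine.Point.some x₂ y₂ h₂ =
            WeierstrassCurve.Affine.Point.some x₂ y₂ h₂ + WeierstrassCurve.Affine.Point.some x₂ y₂ h₂ := by
          rw [hPQ, hRQ, add_self_eq_neg_of_three_zsmul hQ]
        have hQP := add_right_cancel h'
        rw [WeierstrassCurve.Affine.Point.some.injEq] at hQP
        exact hx hQP.1
      · have h' : WeierstrassCurve.Affine.Point.some x₁ y₁ h₁ + WeierstrassCurve.Affine.Point.some x₂ y₂ h₂ =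
            WeierstrassCurve.Affine.Point.some x₂ y₂ h₂ := by rw [hPQ, hRQ, neg_neg]
        exact WeierstrassCurve.Affine.Point.some_ne_zero h₁ (add_eq_right.mp h')
    have h₁₃ : (x₁, y₁) ≠ (x₃, y₃) := by
      intro h
      apply hRP; left
      simp only [Prod.mk.injEq] at h
      rw [WeierstrassCurve.Affine.Point.some.injEq]
      exact ⟨h.1.symm, h.2.symm⟩
    have h₂₃ : (x₂, y₂) ≠ (x₃, y₃) := by
      intro h
      apply hRQ; left
      simp only [Prod.mk.injEq] at h
      rw [WeierstrassCurve.Affine.Point.some.injEq]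
      exact ⟨h.1.symm, h.2.symm⟩
    rw [hPQ, hc.transport_neg hR, hc.transport_eq h₁ hP, hc.transport_eq h₂ hQ, hc.transport_eq h₃ hR]
    -- data on `E`
    have hE₁ := (hc.nonsingular h₁ hP).1
    have hE₂ := (hc.nonsingular h₂ hQ).1
    have hE₃ := (hc.nonsingular h₃ hR).1
    set u₁ := d.u E' x₁ y₁ with hu₁
    set u₂ := d.u E' x₂ y₂ with hu₂
    set u₃ := d.u E' x₃ y₃ with hu₃
    set v₁ := d.v E' x₁ y₁ with hv₁
    set v₂ := d.v E' x₂ y₂ with hv₂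
    set v₃ := d.v E' x₃ y₃ with hv₃
    have hu : u₁ ≠ u₂ := by
      intro h
      rcases hc.eq_or_eq_neg_of_u_eq h₁ h₂ hP hQ h with h' | h'
      · rw [WeierstrassCurve.Affine.Point.some.injEq] at h'; exact hx h'.1
      · rw [WeierstrassCurve.Affine.Point.neg_some, WeierstrassCurve.Affine.Point.some.injEq] at h'; exact hx h'.1
    rw [WeierstrassCurve.Affine.Point.add_of_X_ne' hu, neg_inj]
    set μ := E.toAffine.slope u₁ u₂ v₁ v₂ with hμ
    -- collinearity of `P, Q, R` and of their transports
    have hℓx : ℓ * (x₁ - x₂) = y₁ - y₂ := by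
      rw [hℓ, WeierstrassCurve.Affine.slope_of_X_ne hx, div_mul_cancel₀ _ (sub_ne_zero.2 hx)]
    have hy₃' : y₃ - y₁ = ℓ * (x₃ - x₁) := by rw [hy₃, WeierstrassCurve.Affine.negAddY]; ring
    have hcol : (y₂ - y₁) * (x₃ - x₁) = (y₃ - y₁) * (x₂ - x₁) := by
      rw [hy₃']; linear_combination (x₃ - x₁) * hℓx
    have hcolE : (v₂ - v₁) * (u₃ - u₁) = (v₃ - v₁) * (u₂ - u₁) :=
      hc.collinear_transport h₁ h₂ h₃ hP hQ hR h₁₂ h₁₃ h₂₃ hcol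
    have hμ' : μ = (v₁ - v₂) / (u₁ - u₂) := by rw [hμ, WeierstrassCurve.Affine.slope_of_X_ne hu]
    have hv₃' : v₃ - v₁ = (u₃ - u₁) * μ := by
      rw [hμ', mul_div_assoc', eq_div_iff (sub_ne_zero.2 hu)]
      linear_combination hcolE
    -- the transport of `R` lies on the chord through `U₁, U₂` …
    have hvec : ![u₁, v₁, 1] + (u₃ - u₁) • ![1, μ, 0] = ![u₃, v₃, 1] := by
      ext i
      fin_cases i
      · simp
      · simp only [Fin.mk_one, Pi.add_apply, Matrix.cons_val_one, Matrix.cons_val_zero,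
          Pi.smul_apply, smul_eq_mul]
        linear_combination -hv₃'
      · simp
    have hon : MvPolynomial.eval (![u₁, v₁, 1] + (u₃ - u₁) • ![1, μ, 0])
        E.toProjective.polynomial = 0 := by
      rw [hvec]
      exact (WeierstrassCurve.Projective.equation_some u₃ v₃).2 hE₃
    -- … so by the secant theorem it is `U₁`, `U₂` or `-(U₁ + U₂)`
    rcases (eval_weierstrass_secant_eq_zero_iff E hE₁ hE₂ hu (u₃ - u₁)).1 hon with ht | ht | ht
    · -- `u₃ = u₁`: then `R = ± P`, impossible
      exact absurd (hc.eq_or_eq_neg_of_u_eq h₃ h₁ hR hP (by linear_combination ht)) hRP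
    · -- `u₃ = u₂`: then `R = ± Q`, impossible
      exact absurd (hc.eq_or_eq_neg_of_u_eq h₃ h₂ hR hQ (by linear_combination ht)) hRQ
    · -- the third intersection: `U₃ = (addX, negAddY) = -(U₁ + U₂)`
      have hu₃' : u₃ = E.toAffine.addX u₁ u₂ μ := by linear_combination ht
      have hv₃'' : v₃ = E.toAffine.negAddY u₁ u₂ v₁ μ := by
        rw [WeierstrassCurve.Affine.negAddY, ← hu₃']; linear_combination hv₃'
      rw [WeierstrassCurve.Affine.Point.some.injEq]
      exact ⟨hu₃', hv₃''⟩

/-! ### The induced isomorphism of the `3`-torsion groups -/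

/-- The dual transport restricted to the `3`-torsion subgroups is a homomorphism `E'[3] →+ E[3]`.
[cite: ArtebaniDolgachev2009, §3] [cite: Fisher2012Hessian, §13, Def. 13.1] -/
noncomputable def torsionHom :
    AddSubgroup.torsionBy E'.toAffine.Point 3 →+ AddSubgroup.torsionBy E.toAffine.Point 3 where
  toFun P := ⟨dualTransport E E' d P,
    mem_torsionBy_iff.2 (hc.three_zsmul_transport_eq_zero (mem_torsionBy_iff.1 P.2))⟩
  map_zero' := Subtype.ext (dualTransport_zero E E' d)
  map_add' P Q := Subtype.ext (hc.transport_add (mem_torsionBy_iff.1 P.2)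
    (mem_torsionBy_iff.1 Q.2))

/-- The underlying point of `torsionHom P`. [cite: ArtebaniDolgachev2009, §3] -/
@[simp] theorem coe_torsionHom_apply (P : AddSubgroup.torsionBy E'.toAffine.Point 3) :
    ((hc.torsionHom P : AddSubgroup.torsionBy E.toAffine.Point 3) : E.toAffine.Point) =
      dualTransport E E' d P := rfl

variable [E'.IsElliptic]

/-- The dual transport as an isomorphism `E'[3] ≃+ E[3]` over an algebraically closed field with `3 ≠ 0`:
injective by `transport_injective`, hence bijective since `#E[3] = #E'[3] = 9` (tree `card_torsionBy_three`).
[cite: ArtebaniDolgachev2009, §3] [cite: SilvermanTate2015, §2.1, Thm. 2.1 (d)] -/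
noncomputable def torsionEquiv [IsAlgClosed K] (h3 : (3 : K) ≠ 0) :
    AddSubgroup.torsionBy E'.toAffine.Point 3 ≃+ AddSubgroup.torsionBy E.toAffine.Point 3 :=
  AddEquiv.ofBijective hc.torsionHom (by
    have hinj : Function.Injective hc.torsionHom := fun P Q h =>
      Subtype.ext (hc.transport_injective (mem_torsionBy_iff.1 P.2) (mem_torsionBy_iff.1 Q.2)
        (congrArg Subtype.val h))
    have hE : Nat.card (AddSubgroup.torsionBy E.toAffine.Point 3) = 9 := card_torsionBy_three E h3
    have hE' : Nat.card (AddSubgroup.torsionBy E'.toAffine.Point 3) = 9 := card_torsionBy_three E' h3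
    haveI : Finite (AddSubgroup.torsionBy E.toAffine.Point 3) := Nat.finite_of_card_ne_zero (by omega)
    exact hinj.bijective_of_nat_card_le (by omega))

/-- The underlying point of `torsionEquiv P`. [cite: ArtebaniDolgachev2009, §3] -/
@[simp] theorem coe_torsionEquiv_apply [IsAlgClosed K] (h3 : (3 : K) ≠ 0)
    (P : AddSubgroup.torsionBy E'.toAffine.Point 3) :
    ((hc.torsionEquiv h3 P : AddSubgroup.torsionBy E.toAffine.Point 3) : E.toAffine.Point) =
      dualTransport E E' d P := rfl

end IsDualFlexTransport

end DualTransport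


/-! ## Curves over a field `F`: Galois equivariance and the (reverse) mod-`3` congruence -/

section DualGalois

variable {F : Type u} [Field F] (d₀ : DualDatum F)

/-- The dual transport over `F` commutes with `F`-automorphisms (abscissa). [cite: SilvermanAEC2009, III.§7 (the Galois module E[m])] -/
theorem DualDatum.algEquiv_u (W' : WeierstrassCurve F) {L : Type u} [Field L] [Algebra F L] (σ : L ≃ₐ[F] L)
    (x y : L) :
    σ ((d₀.map (algebraMap F L)).u (W'.baseChange L) x y) =
      (d₀.map (algebraMap F L)).u (W'.baseChange L) (σ x) (σ y) := by
  simp [DualDatum.u, DualDatum.vec, DualDatum.mat, DualDatum.map, hhat, Matrix.mulVec, dotProduct,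
    Fin.sum_univ_three, map_div₀, map_ofNat, WeierstrassCurve.baseChange, WeierstrassCurve.map_a₁,
    WeierstrassCurve.map_a₂, WeierstrassCurve.map_a₃, WeierstrassCurve.map_a₄, WeierstrassCurve.map_a₆]

/-- The dual transport over `F` commutes with `F`-automorphisms (ordinate). [cite: SilvermanAEC2009, III.§7 (the Galois module E[m])] -/
theorem DualDatum.algEquiv_v (W' : WeierstrassCurve F) {L : Type u} [Field L] [Algebra F L] (σ : L ≃ₐ[F] L)
    (x y : L) :
    σ ((d₀.map (algebraMap F L)).v (W'.baseChange L) x y) =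
      (d₀.map (algebraMap F L)).v (W'.baseChange L) (σ x) (σ y) := by
  simp [DualDatum.v, DualDatum.vec, DualDatum.mat, DualDatum.map, hhat, Matrix.mulVec, dotProduct,
    Fin.sum_univ_three, map_div₀, map_ofNat, WeierstrassCurve.baseChange, WeierstrassCurve.map_a₁,
    WeierstrassCurve.map_a₂, WeierstrassCurve.map_a₃, WeierstrassCurve.map_a₄, WeierstrassCurve.map_a₆]

variable (W W' : WeierstrassCurve F) [W.IsElliptic]

/-- **Galois equivariance** of the dual transport (defined over `F`). [cite: SilvermanAEC2009, III.§7 (the Galois module E[m])] -/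
theorem dualTransport_smul {L : Type u} [Field L] [Algebra F L]
    (hc : IsDualFlexTransport (W.baseChange L) (W'.baseChange L) (d₀.map (algebraMap F L)))
    (σ : L ≃ₐ[F] L) {P : (W'.baseChange L).toAffine.Point} (hP : (3 : ℤ) • P = 0) :
    dualTransport (W.baseChange L) (W'.baseChange L) (d₀.map (algebraMap F L)) (σ • P) =
      σ • dualTransport (W.baseChange L) (W'.baseChange L) (d₀.map (algebraMap F L)) P := by
  rcases P with _ | ⟨x, y, h⟩
  · rw [← WeierstrassCurve.Affine.Point.zero_def, smul_zero, dualTransport_zero, smul_zero]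
  · have hP' : (3 : ℤ) • WeierstrassCurve.Affine.Point.map (σ : L →ₐ[F] L)
        (WeierstrassCurve.Affine.Point.some x y h) = 0 := by
      rw [← WeierstrassCurve.smul_def, smul_comm, hP, smul_zero]
    rw [WeierstrassCurve.Affine.Point.map_some] at hP'
    rw [WeierstrassCurve.smul_def, WeierstrassCurve.Affine.Point.map_some, hc.transport_eq _ hP',
      hc.transport_eq h hP, WeierstrassCurve.smul_def, WeierstrassCurve.Affine.Point.map_some,
      WeierstrassCurve.Affine.Point.some.injEq]
    exact ⟨(d₀.algEquiv_u W' σ x y).symm, (d₀.algEquiv_v W' σ x y).symm⟩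

/-- **Reverse mod-`3` congruence by the dual (harmonic-polar) transport.** Let `W, W'` be elliptic curves
over a field `F` with `3 ≠ 0`, and `M′ ∈ GL₃(F)` a matrix such that `(x, y) ↦ M′·ĥ_{W'}(x, y)` (the image of
the harmonic polar of the flex) carries every affine flex of `W'` over `F̄` to an affine flex of `W`,
intertwines the negations, and has `M′ᵀ` as a left inverse on flexes (`IsDualFlexTransport`). Then there is a
`Gal(F̄/F)`-equivariant isomorphism `W'[3] ≃+ W[3]` of the geometric `3`-torsion — for `F = ℚ` VERBATIM the body
of `O6.ModPCongruent W' W 3`. This is the road for REVERSE (anti-symplectic) congruences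
[cite: Fisher2012Hessian, §13, Def. 13.1 (X_E^-(n))], complementary to `exists_addEquiv_geomTorsion_three`:
the nine harmonic polars of `W'` are the base points of the dual Hesse pencil [cite: ArtebaniDolgachev2009, §3],
with the same collinearities as the flexes (`det_hhat_eq_zero_of_collinear`), so a projectivity of the dual
plane onto the plane of `W` carrying them to `W[3]` is a group isomorphism; Galois-equivariant because defined
over `F`; bijective since `#E[3] = 9` [cite: SilvermanTate2015, §2.1, Thm. 2.1 (d)]. -/
theorem exists_addEquiv_geomTorsion_three_dual [W'.IsElliptic] (h3 : (3 : F) ≠ 0)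
    (hc : IsDualFlexTransport (W.baseChange (AlgebraicClosure F)) (W'.baseChange (AlgebraicClosure F))
      (d₀.map (algebraMap F (AlgebraicClosure F)))) :
    ∃ e : W'.geomTorsion 3 ≃+ W.geomTorsion 3,
      ∀ (σ : Field.absoluteGaloisGroup F) (P : W'.geomTorsion 3), e (σ • P) = σ • e P := by
  have h3K : (3 : AlgebraicClosure F) ≠ 0 := by
    rw [← map_ofNat (algebraMap F (AlgebraicClosure F)) 3]
    exact (map_ne_zero (algebraMap F (AlgebraicClosure F))).mpr h3
  refine ⟨hc.torsionEquiv h3K, fun σ P => ?_⟩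
  apply Subtype.ext
  rw [AddSubgroup.torsionBy.coe_smul]
  change dualTransport _ _ _ ((σ • P : W'.geomTorsion 3) : W'.geomPoints) =
    (show AlgebraicClosure F ≃ₐ[F] AlgebraicClosure F from σ) • dualTransport _ _ _ (P : W'.geomPoints)
  rw [AddSubgroup.torsionBy.coe_smul]
  exact dualTransport_smul d₀ W W' hc (show AlgebraicClosure F ≃ₐ[F] AlgebraicClosure F from σ)
    (mem_torsionBy_iff.1 P.2)

end DualGalois


/-! ## The certificate in coordinates (the form produced by computer algebra) -/

section DualCertificate

variable {F : Type u} [Field F] {L : Type u} [Field L] [Algebra F L]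

/-- **The reverse-congruence certificate, spelled out** for the base changes to `L ⊇ F` of curves `W, W'` and a
dual datum `M′` over `F`: `2 ≠ 0`, `det M′ ≠ 0`, the intertwining `M′N′ᵀ = N M′` (a `3 × 3` identity over `F`),
and for all `(x, y) ∈ L²` on `W'` with `Ψ₃^{W'}(x) = 0`, writing `(U, V, Z) = M′ĥ_{W'}(x, y)` and
`T = M′ᵀ ĥ^hom_W(U, V, Z)`: `Z ≠ 0`, the homogeneous Weierstrass cubic of `W` vanishes at `(U, V, Z)`, the
homogenised `Ψ₃^{W}` vanishes at `(U, Z)`, `T₂ ≠ 0`, `T₀ = xT₂`, `T₁ = yT₂` — in practice ideal-membership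
identities modulo `(W'(x, y), Ψ₃^{W'}(x))` closed by `linear_combination`. [cite: ArtebaniDolgachev2009, §3 (the
dual Hesse pencil)] [cite: Fisher2012Hessian, §13, Def. 13.1] -/
theorem IsDualFlexTransport.of_baseChange (W W' : WeierstrassCurve F) (d₀ : DualDatum F)
    (h2 : (2 : F) ≠ 0) (hdet : d₀.mat.det ≠ 0)
    (hneg : d₀.mat * Matrix.of ![![(1 : F), -W'.a₁, 0], ![0, -1, 0], ![0, -W'.a₃, 1]] =
      Matrix.of ![![(1 : F), 0, 0], ![-W.a₁, -1, -W.a₃], ![0, 0, 1]] * d₀.mat)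
    (hcert : ∀ x y : L,
      y ^ 2 + algebraMap F L W'.a₁ * x * y + algebraMap F L W'.a₃ * y =
        x ^ 3 + algebraMap F L W'.a₂ * x ^ 2 + algebraMap F L W'.a₄ * x + algebraMap F L W'.a₆ →
      3 * x ^ 4 + algebraMap F L W'.b₂ * x ^ 3 + 3 * algebraMap F L W'.b₄ * x ^ 2 +
        3 * algebraMap F L W'.b₆ * x + algebraMap F L W'.b₈ = 0 →
      (d₀.map (algebraMap F L)).vec (W'.baseChange L) x y 2 ≠ 0 ∧
      (d₀.map (algebraMap F L)).vec (W'.baseChange L) x y 1 ^ 2 *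
            (d₀.map (algebraMap F L)).vec (W'.baseChange L) x y 2 +
          algebraMap F L W.a₁ * (d₀.map (algebraMap F L)).vec (W'.baseChange L) x y 0 *
            (d₀.map (algebraMap F L)).vec (W'.baseChange L) x y 1 *
            (d₀.map (algebraMap F L)).vec (W'.baseChange L) x y 2 +
          algebraMap F L W.a₃ * (d₀.map (algebraMap F L)).vec (W'.baseChange L) x y 1 *
            (d₀.map (algebraMap F L)).vec (W'.baseChange L) x y 2 ^ 2 =
        (d₀.map (algebraMap F L)).vec (W'.baseChange L) x y 0 ^ 3 +
          algebraMap F L W.a₂ * (d₀.map (algebraMap F L)).vec (W'.baseChange L) x y 0 ^ 2 *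
            (d₀.map (algebraMap F L)).vec (W'.baseChange L) x y 2 +
          algebraMap F L W.a₄ * (d₀.map (algebraMap F L)).vec (W'.baseChange L) x y 0 *
            (d₀.map (algebraMap F L)).vec (W'.baseChange L) x y 2 ^ 2 +
          algebraMap F L W.a₆ * (d₀.map (algebraMap F L)).vec (W'.baseChange L) x y 2 ^ 3 ∧
      3 * (d₀.map (algebraMap F L)).vec (W'.baseChange L) x y 0 ^ 4 +
          algebraMap F L W.b₂ * (d₀.map (algebraMap F L)).vec (W'.baseChange L) x y 0 ^ 3 *
            (d₀.map (algebraMap F L)).vec (W'.baseChange L) x y 2 +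
          3 * algebraMap F L W.b₄ * (d₀.map (algebraMap F L)).vec (W'.baseChange L) x y 0 ^ 2 *
            (d₀.map (algebraMap F L)).vec (W'.baseChange L) x y 2 ^ 2 +
          3 * algebraMap F L W.b₆ * (d₀.map (algebraMap F L)).vec (W'.baseChange L) x y 0 *
            (d₀.map (algebraMap F L)).vec (W'.baseChange L) x y 2 ^ 3 +
          algebraMap F L W.b₈ * (d₀.map (algebraMap F L)).vec (W'.baseChange L) x y 2 ^ 4 = 0 ∧
      ((d₀.map (algebraMap F L)).matᵀ *ᵥ hhatH (W.baseChange L)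
          ((d₀.map (algebraMap F L)).vec (W'.baseChange L) x y)) 2 ≠ 0 ∧
      ((d₀.map (algebraMap F L)).matᵀ *ᵥ hhatH (W.baseChange L)
          ((d₀.map (algebraMap F L)).vec (W'.baseChange L) x y)) 0 =
        x * ((d₀.map (algebraMap F L)).matᵀ *ᵥ hhatH (W.baseChange L)
          ((d₀.map (algebraMap F L)).vec (W'.baseChange L) x y)) 2 ∧
      ((d₀.map (algebraMap F L)).matᵀ *ᵥ hhatH (W.baseChange L)
          ((d₀.map (algebraMap F L)).vec (W'.baseChange L) x y)) 1 =
        y * ((d₀.map (algebraMap F L)).matᵀ *ᵥ hhatH (W.baseChange L)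
          ((d₀.map (algebraMap F L)).vec (W'.baseChange L) x y)) 2) :
    IsDualFlexTransport (W.baseChange L) (W'.baseChange L) (d₀.map (algebraMap F L)) where
  two_ne_zero := by
    rw [← map_ofNat (algebraMap F L) 2]; exact (map_ne_zero (algebraMap F L)).mpr h2
  det_ne_zero := by
    rw [DualDatum.map_mat]
    have : (d₀.mat.map (algebraMap F L)).det = algebraMap F L d₀.mat.det := by
      rw [RingHom.map_det, RingHom.mapMatrix_apply]
    rw [this]; exact (map_ne_zero (algebraMap F L)).mpr hdet
  neg := by
    have h := congrArg (RingHom.mapMatrix (algebraMap F L)) hneg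
    rw [map_mul, map_mul] at h
    rw [DualDatum.map_mat]
    have e1 : (RingHom.mapMatrix (algebraMap F L))
        (Matrix.of ![![(1 : F), -W'.a₁, 0], ![0, -1, 0], ![0, -W'.a₃, 1]]) =
        Matrix.of ![![(1 : L), -(W'.baseChange L).a₁, 0], ![0, -1, 0], ![0, -(W'.baseChange L).a₃, 1]] := by
      ext i j; fin_cases i <;> fin_cases j <;> simp [WeierstrassCurve.baseChange]
    have e2 : (RingHom.mapMatrix (algebraMap F L))
        (Matrix.of ![![(1 : F), 0, 0], ![-W.a₁, -1, -W.a₃], ![0, 0, 1]]) =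
        Matrix.of ![![(1 : L), 0, 0], ![-(W.baseChange L).a₁, -1, -(W.baseChange L).a₃], ![0, 0, 1]] := by
      ext i j; fin_cases i <;> fin_cases j <;> simp [WeierstrassCurve.baseChange]
    rw [e1, e2, RingHom.mapMatrix_apply] at h
    exact h
  cert x y hE hΨ := by
    have hE' := hE
    rw [WeierstrassCurve.Affine.equation_iff] at hE'
    simp only [WeierstrassCurve.baseChange, WeierstrassCurve.map_a₁, WeierstrassCurve.map_a₂,
      WeierstrassCurve.map_a₃, WeierstrassCurve.map_a₄, WeierstrassCurve.map_a₆] at hE'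
    have hΨ' := hΨ
    simp only [WeierstrassCurve.baseChange, WeierstrassCurve.Ψ₃, WeierstrassCurve.map_b₂,
      WeierstrassCurve.map_b₄, WeierstrassCurve.map_b₆, WeierstrassCurve.map_b₈, Polynomial.eval_add,
      Polynomial.eval_mul, Polynomial.eval_pow, Polynomial.eval_C, Polynomial.eval_X,
      Polynomial.eval_ofNat] at hΨ'
    obtain ⟨hZ, hF, hQ, -, -, -⟩ := hcert x y hE' hΨ'
    set U := (d₀.map (algebraMap F L)).vec (W'.baseChange L) x y 0 with hU
    set V := (d₀.map (algebraMap F L)).vec (W'.baseChange L) x y 1 with hV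
    set Z := (d₀.map (algebraMap F L)).vec (W'.baseChange L) x y 2 with hZdef
    have hu : (d₀.map (algebraMap F L)).u (W'.baseChange L) x y = U / Z := rfl
    have hv : (d₀.map (algebraMap F L)).v (W'.baseChange L) x y = V / Z := rfl
    refine ⟨hZ, ?_, ?_⟩
    · rw [hu, hv, WeierstrassCurve.Affine.equation_iff]
      simp only [WeierstrassCurve.baseChange, WeierstrassCurve.map_a₁, WeierstrassCurve.map_a₂,
        WeierstrassCurve.map_a₃, WeierstrassCurve.map_a₄, WeierstrassCurve.map_a₆]
      field_simp
      linear_combination hF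
    · rw [hu]
      simp only [WeierstrassCurve.baseChange, WeierstrassCurve.Ψ₃, WeierstrassCurve.map_b₂,
        WeierstrassCurve.map_b₄, WeierstrassCurve.map_b₆, WeierstrassCurve.map_b₈, Polynomial.eval_add,
        Polynomial.eval_mul, Polynomial.eval_pow, Polynomial.eval_C, Polynomial.eval_X,
        Polynomial.eval_ofNat]
      field_simp
      linear_combination hQ
  inv x y hE hΨ := by
    have hE' := hE
    rw [WeierstrassCurve.Affine.equation_iff] at hE'
    simp only [WeierstrassCurve.baseChange, WeierstrassCurve.map_a₁, WeierstrassCurve.map_a₂,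
      WeierstrassCurve.map_a₃, WeierstrassCurve.map_a₄, WeierstrassCurve.map_a₆] at hE'
    have hΨ' := hΨ
    simp only [WeierstrassCurve.baseChange, WeierstrassCurve.Ψ₃, WeierstrassCurve.map_b₂,
      WeierstrassCurve.map_b₄, WeierstrassCurve.map_b₆, WeierstrassCurve.map_b₈, Polynomial.eval_add,
      Polynomial.eval_mul, Polynomial.eval_pow, Polynomial.eval_C, Polynomial.eval_X,
      Polynomial.eval_ofNat] at hΨ'
    obtain ⟨-, -, -, hT2, hT0, hT1⟩ := hcert x y hE' hΨ'
    exact ⟨hT2, hT0, hT1⟩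

end DualCertificate

end Literature.NumberTheory.EllipticCurves.FlexTransport
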